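import Summits.QuantumFields.YangMills.Theorems.AlphaInputsT3ACv3ZfullFloor
import HarnessLib

/-!
# `UnitScaleTiltHistoryTailOneSupplierWindowSplit` — THE TWO-SUPPLIER SPLIT OF THE ONE-SUPPLIER THEOREMS **IN WINDOW CURRENCY**: `HistoryTailL` ⇐ ⟨T8 text⟩ ∧ ⟨the (FL) team's
# END THEOREM = the M22 big-k clause `hLift_clause_of_start`, universally closed over records, families, couplings and runs, at its own numerals `(B_big, ε_FL > 0)`⟩ ∧ ⟨NODE O's
# (O″χ) χ data rows, VERBATIM the `hO` of ★w5-19936 g0's `…OneSupplierSplit`⟩ — so that the (FL) side's deliverable mentions NO record rows and NO data, and the (O″χ) side's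
# target is UNCHANGED — cell `ym3-torus`, route `UnitScaleTilt`, crux stmt-QuantumFields-19936 (v5p9, 2′χ) and item 19935 (2′), width seat `ym-ust-19936-w2` (g3)

WHY.  ★alpha-2 g6's `…OneSupplierWindow` (✓ p603716) reads (FL) as the WINDOWED `hLift` binder bundled, per exhibited record, inside `hrows` together with the window row
`avgWindowFactor L ≤ 8·B₃·Z_full·ε_FL` (★★OWNER g25 RULING (FL-SMALL) (c′)) and the data rows; `…OneSupplierSplit` separates the (FL) team's deliverable from NODE O's — in the
non-window currency.  The (FL) assembly of record (M22: ★w4-19936 g3 `hLift_clause_of_start` ∘ LEAD ★w1 g2 `startT3_cert_omega` ∘ (H)) delivers the BIG-k CLAUSE under an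
explicit window `0 < ε′ ≤ ε_FL(L)` and nothing else; `…HLiftWindowKnit` (this seat, ✓ p606019) turns «small-k ✓`hLift_small` ⊕ big-k clause» into the windowed binder given the
floor `max (B_big+1) 257 · L² ≤ B₃` and the window row; ★w6-19936 g0's `…ZfullFloor` shows `Z_full ≥ 3` for EVERY record, so the window row is itself a B₃-FLOOR row
(`avgWindowFactor L ∕ (24·ε_FL) ≤ B₃`, `windowRow_of_floor`).  THIS FILE is the split in window currency with BOTH rows absorbed into the served floor
`max B₀ (max (max (B_big+1) 257 · L²) (avgWindowFactor L ∕ (24·ε_FL)))` inside the proof: the (FL) hypothesis is LITERALLY the big-k clause quantified over `(F, 𝔠, γ, K)`,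
the (O″χ) hypothesis is `…OneSupplierSplit`'s `hO` verbatim.
WHAT (def-free).  §1 ★★ `pinnedPartsT3ACRecFLChi_of_thm1_bigClause_dataRows` (χ display), `alphaInputsT3ACv3RecChi_of_thm1_bigClause_dataRows` (registered 2′χ text);
§2 ★★★ `historyTailL_of_thm1In8_bigClause_dataRows_allL` — stmt-QuantumFields-19936 BY NAME from ⟨T8⟩ ∧ (∀ odd `L > 1`, `∃ B_big, ε_FL > 0`, the clause) ∧ (∀ odd `L > 1`,
NODE O's `hO`); §3 the plain twins for item 19935 (`pinnedPartsT3ACRecFL_of_thm1_bigClause_dataRows`, `alphaInputsT3ACv3Rec_of_thm1_bigClause_dataRows`).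
HONEST FRAMING.  Restriction of quantifiers over landed theorems; every hypothesis (T8, the big-k clause = START + Newton, the χ∕plain data rows) is analytic content NOT proved
here; the stub `stub_laneRecordsV3Chi`, the crux `HistoryTailL`, item 19935 and any gap are NOT closed; count-neutral helper (`--supports stmt-QuantumFields-19936`); registry
untouched.  YM₃ on the three-torus is rung R3 of the programme, NOT the Clay problem: nothing here bears on d = 4, infinite volume, or a mass gap.

References: T. Bałaban, Commun. Math. Phys. 102 (1985) 277–309 [Balaban1985Variational] (Thm 1 (6)–(8) pp.278–279, (11)–(15) pp.279–280, Prop 8 p.304); Commun. Math. Phys.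
102 (1985) 255–275 [Balaban1985UV3] ((5) p.256, (7) p.257, (38)–(42) p.266, (45)+(47) p.267, (68)+(71) p.273, Thm 2 p.272); C. King, Commun. Math. Phys. 102 (1986) 649–677
[King1986] ((3.12) p.657).
-/

set_option autoImplicit false

noncomputable section

namespace Summit.QuantumFields.YangMills.Theorems.HistoryTailOneSupplier

open MeasureTheory Set
open scoped Matrix.Norms.L2Operator
open Literature.MathematicalPhysics.QuantumFieldTheory.Balaban1983to89
open Literature.MathematicalPhysics.QuantumFieldTheory.Balaban1983to89.T3ContinuumYM3Torus
open Literature.MathematicalPhysics.QuantumFieldTheory.Balaban1983to89.T3UnitLawDensityEML (ℰp)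
open Literature.MathematicalPhysics.QuantumFieldTheory.Balaban1983to89.T3UnitScaleTilt (θBal)
open Literature.MathematicalPhysics.QuantumFieldTheory.Balaban1983to89.T3PrintedMinimiserExistence (Thm1GlobalMinAt)
open Literature.MathematicalPhysics.QuantumFieldTheory.Balaban1983to89.T3LowerAlongMinimisersSplit (MinimisersIn8At)
open Literature.MathematicalPhysics.QuantumFieldTheory.Balaban1983to89.ExpMeanLog (deltaSU deltaSU_pos)
open Literature.MathematicalPhysics.QuantumFieldTheory.Balaban1983to89.B10Eq38TorusDomains (plaqsIn)
open Literature.MathematicalPhysics.QuantumFieldTheory.Balaban1983to89.B10Eq42TorusConstraint (bondsIn)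
open Literature.MathematicalPhysics.QuantumFieldTheory.Balaban1985CMP102.Setting
open Summit.QuantumFields.Balaban3D.Carriers
open Summit.QuantumFields.Balaban3D.Proofs.Primitives
open Summit.QuantumFields.Balaban3D.Proofs.Thresholds (Q0 Q0_pos)
open Summit.QuantumFields.YangMills.Theorems.RecordFLOneSupplier (pinnedPartsT3ACRecFL_of_thm1_rows)
open Summit.QuantumFields.YangMills.Theorems.HLiftWindowKnit (innerFineLiftsT3_of_clauses)
open B7Prop2Explicit (C0 C0_pos)

/-! ## §1 The χ display and the 2′χ text from (T), the big-k clause, and the (O″χ) rows -/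

/-- ★★ **THE 2′χ DISPLAY FROM (T) AT ANY CONSTANTS, THE (FL) BIG-k CLAUSE, AND THE (O″χ) ROWS.**  `hBig` (the (FL) team's END THEOREM, displayed; `ε_FL > 0`): for every family `F`
of block size `L`, every record `𝔠` over `F.L`, every coupling in the record's window and every run length `K`: for `k + 1 ≤ K` with `16 ≤ Lᵏ`, `4Lᵏ ≤ N₀`, every admissible
non-trivial `h`, every level-`k` field `V` and every `0 < ε′ ≤ ε_FL` windowing `V` on `plaqsIn k Ω_{k+1}(h)`, an exact `k`-fold lift with constrained finest plaquettes
`≤ B_big·(ε′∕(Lᵏ)²)` (M22's concluding shape).  `hO`: VERBATIM the (O″χ) rows of `…OneSupplierSplit.pinnedPartsT3ACRecFLChi_of_thm1_fineLifts_dataRows`.  Then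
`PinnedPartsT3ACRecFLChi L` — `pinnedPartsT3ACRecFLChi_of_thm1_rows` at the served floor `max B₀ (max (max (B_big+1) 257 · L²) (avgWindowFactor L ∕ (24·ε_FL)))`, the window row by
`HLiftWindowKnit.windowRow_of_floor` (`Z_full ≥ 3`), the (FL) conjunct by `HLiftWindowKnit.innerFineLiftsT3_of_clauses`. [cite: Balaban1985Variational, Thm 1 (6)–(8) pp.278–279, (11)–(15) pp.279–280; Balaban1985UV3, (7) p.257, (38)–(42) p.266, (45)+(47) p.267, (68) p.273 and Thm 2 p.272] -/
theorem pinnedPartsT3ACRecFLChi_of_thm1_bigClause_dataRows {L : ℕ} (hL : 1 < L)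
    (hT : ∃ a₀ a₁ B₃ : ℝ, 0 < a₀ ∧ 0 < a₁ ∧ 0 < B₃ ∧ Thm1GlobalMinAt L a₀ a₁ B₃)
    {Bbig εFL : ℝ} (hε : 0 < εFL)
    (hBig : ∀ (F : T3Family) (hF : F.L = L) (𝔠 : AlphaConsts F.L (suGroupModel 2).N) (γ : ℝ) (hγ : 0 < γ) (hγ1 : γ ≤ (min 𝔠.gamma0 1) ^ 2) (K : ℕ),
      ∀ (k : ℕ), k + 1 ≤ K → 16 ≤ (F.P K).L ^ k → 4 * (F.P K).L ^ k ≤ (F.P K).sitesPerDir 0 → ∀ (h : Hist (F.P K) (k + 1)),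
      Hist.Admissible 𝔠.lane.carrier.M₁ (rcolOf (T3Scales F γ hγ (hγ1.trans (sq_min_one_le _ 𝔠.gamma0_pos)) K) 𝔠.lane.carrier) (k + 1) h →
      h ≠ Hist.triv (F.P K) (k + 1) → ∀ (V : GaugeField (F.P K) k (Matrix.specialUnitaryGroup (Fin 2) ℂ)) (ε' : ℝ), 0 < ε' → ε' ≤ εFL →
        (∀ Q : Plaq (F.P K) k, Q ∈ plaqsIn k (Omega 𝔠.lane.carrier.M₁
            (rcolOf (T3Scales F γ hγ (hγ1.trans (sq_min_one_le _ 𝔠.gamma0_pos)) K) 𝔠.lane.carrier) (k + 1) h (k + 1)) →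
          GaugeGroup.dist1 (GaugeField.plaqHol V Q) ≤ ε') →
        ∃ U : GaugeField (F.P K) 0 (Matrix.specialUnitaryGroup (Fin 2) ℂ),
          (∀ b : PBond (F.P K) k, b ∈ bondsIn k (Omega 𝔠.lane.carrier.M₁
              (rcolOf (T3Scales F γ hγ (hγ1.trans (sq_min_one_le _ 𝔠.gamma0_pos)) K) 𝔠.lane.carrier) (k + 1) h (k + 1)) →
            Averaging.iter (fun i => BlockAveraging.blockAvg (P := F.P K) (j := i) ℰp) k U b = V b) ∧
          ∀ q : Plaq (F.P K) 0, q ∈ plaqsIn 0 (Omega 𝔠.lane.carrier.M₁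
              (rcolOf (T3Scales F γ hγ (hγ1.trans (sq_min_one_le _ 𝔠.gamma0_pos)) K) 𝔠.lane.carrier) (k + 1) h (k + 1)) →
            GaugeGroup.dist1 (GaugeField.plaqHol U q) ≤ Bbig * (ε' / (((F.P K).L : ℝ) ^ k) ^ 2))
    {B₀ A₀ A₁ : ℝ} (hA₀ : 0 < A₀) (hA₁ : 0 < A₁)
    (hO : ∀ (B a₀ a₁ : ℝ), B₀ ≤ B → 1 ≤ 2 * B → 0 < a₀ → a₀ ≤ A₀ → 0 < a₁ → a₁ ≤ A₁ → B * a₁ ≤ a₀ →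
        (143 * ((((3 + 4 : ℕ) : ℝ)) ^ 2 / 4) ^ 2) * (2 * (B * a₁)) ≤ 1 / 3 →
        2 * (2 * (B * a₁)) ≤ 2 * deltaSU (Fin 2) / (((3 + 4) * L : ℕ) : ℝ) ^ 2 →
        Thm1GlobalMinAt L a₀ a₁ B →
        ∃ (b₁ p₁ : ℝ), ∀ (b₀ p₀ : ℝ), b₁ ≤ b₀ → p₁ ≤ p₀ →
          ∃ 𝔠 : AlphaConsts L (suGroupModel 2).N, 𝔠.b₀ = b₀ ∧ 𝔠.p₀ = p₀ ∧ 𝔠.B₃ = B ∧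
            4 * 𝔠.B₃ * (L : ℝ) ^ 2 * avgWindowFactor L ≤ 𝔠.C68 ∧
            Real.exp (𝔠.p₀ - 1) ≤ 3 * C0 3 * 𝔠.C68 * (𝔠.b₀ * Q0 𝔠.p₀) ∧
            (𝔠.b₀ * Q0 𝔠.p₀) * (2 * (L : ℝ) ^ 2 * avgWindowFactor L) ^ 2 ≤ 3 * C0 3 * 𝔠.C68 * a₁ ^ 2 ∧
            7 * L + 3 ≤ 𝔠.M₁ ∧
            ∀ (F : T3Family) (hF : F.L = L),
              (∀ (γ : ℝ) (hγ : 0 < γ) (hγ1 : γ ≤ (min (hF ▸ 𝔠).gamma0 1) ^ 2) (K : ℕ),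
                (∃ Ut : (k : ℕ) → GaugeField (F.P K) k (Matrix.specialUnitaryGroup (Fin 2) ℂ) →
                    GaugeField (F.P K) 0 (Matrix.specialUnitaryGroup (Fin 2) ℂ),
                  AlphaInputsT3AC.TrivMinimiserRowsT3 F (hF ▸ 𝔠) γ hγ hγ1 a₀ a₁ K Ut) →
                ∃ Ut : (k : ℕ) → GaugeField (F.P K) k (Matrix.specialUnitaryGroup (Fin 2) ℂ) →
                    GaugeField (F.P K) 0 (Matrix.specialUnitaryGroup (Fin 2) ℂ),
                  AlphaInputsT3AC.TrivMinimiserRowsT3 F (hF ▸ 𝔠) γ hγ hγ1 a₀ a₁ K Ut ∧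
                    AlphaInputsT3AC.DataRowsT3XChi F (hF ▸ 𝔠) γ hγ hγ1 K Ut)) :
    AlphaInputsT3AC.PinnedPartsT3ACRecFLChi L := by
  refine pinnedPartsT3ACRecFLChi_of_thm1_rows hL hT hA₀ hA₁ (B₀ := max B₀ (max (max (Bbig + 1) 257 * (L : ℝ) ^ 2) (avgWindowFactor L / (24 * εFL))))
    fun B a₀ a₁ h1 h2 h3 h4 h5 h6 h7 h8 h9 h10 => ?_
  obtain ⟨b₁, p₁, hrec⟩ := hO B a₀ a₁ ((le_max_left _ _).trans h1) h2 h3 h4 h5 h6 h7 h8 h9 h10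
  refine ⟨b₁, p₁, fun b₀ p₀ hb hp => ?_⟩
  obtain ⟨𝔠, e1, e2, e3, s1, s2, s3, s4, hOF⟩ := hrec b₀ p₀ hb hp
  refine ⟨𝔠, e1, e2, e3, s1, s2, s3, s4, fun F hF => ⟨fun γ hγ hγ1 K => ?_, hOF F hF⟩⟩
  have hfl : max (max (Bbig + 1) 257 * (L : ℝ) ^ 2) (avgWindowFactor L / (24 * εFL)) ≤ 𝔠.B₃ := by
    rw [e3]; exact (le_max_right _ _).trans h1
  have hBB : max (Bbig + 1) 257 * (L : ℝ) ^ 2 ≤ 𝔠.B₃ := (le_max_left _ _).trans hfl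
  have hrow : avgWindowFactor L ≤ 8 * 𝔠.B₃ * 𝔠.Zfull * εFL := HLiftWindowKnit.windowRow_of_floor 𝔠 hε ((le_max_right _ _).trans hfl)
  subst hF
  exact innerFineLiftsT3_of_clauses F 𝔠 γ hγ hγ1 K hBB hrow (hBig F rfl 𝔠 γ hγ hγ1 K)

/-- ★★ **THE REGISTERED 2′χ TEXT `AlphaInputsT3ACv3RecChi L` FROM (T), THE BIG-k CLAUSE, AND THE (O″χ) ROWS** (§1 through w2 g0's
`alphaInputsT3ACv3RecChi_of_pinnedPartsRecFLChi`); serves 20520's v5kC 2′χ identically. [cite: Balaban1985UV3, Thm 2 p.272 and (47) p.267; Balaban1985Variational, Thm 1 (8) p.279] -/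
theorem alphaInputsT3ACv3RecChi_of_thm1_bigClause_dataRows {L : ℕ} (hL : 1 < L)
    (hT : ∃ a₀ a₁ B₃ : ℝ, 0 < a₀ ∧ 0 < a₁ ∧ 0 < B₃ ∧ Thm1GlobalMinAt L a₀ a₁ B₃)
    {Bbig εFL : ℝ} (hε : 0 < εFL)
    (hBig : ∀ (F : T3Family) (hF : F.L = L) (𝔠 : AlphaConsts F.L (suGroupModel 2).N) (γ : ℝ) (hγ : 0 < γ) (hγ1 : γ ≤ (min 𝔠.gamma0 1) ^ 2) (K : ℕ),
      ∀ (k : ℕ), k + 1 ≤ K → 16 ≤ (F.P K).L ^ k → 4 * (F.P K).L ^ k ≤ (F.P K).sitesPerDir 0 → ∀ (h : Hist (F.P K) (k + 1)),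
      Hist.Admissible 𝔠.lane.carrier.M₁ (rcolOf (T3Scales F γ hγ (hγ1.trans (sq_min_one_le _ 𝔠.gamma0_pos)) K) 𝔠.lane.carrier) (k + 1) h →
      h ≠ Hist.triv (F.P K) (k + 1) → ∀ (V : GaugeField (F.P K) k (Matrix.specialUnitaryGroup (Fin 2) ℂ)) (ε' : ℝ), 0 < ε' → ε' ≤ εFL →
        (∀ Q : Plaq (F.P K) k, Q ∈ plaqsIn k (Omega 𝔠.lane.carrier.M₁
            (rcolOf (T3Scales F γ hγ (hγ1.trans (sq_min_one_le _ 𝔠.gamma0_pos)) K) 𝔠.lane.carrier) (k + 1) h (k + 1)) →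
          GaugeGroup.dist1 (GaugeField.plaqHol V Q) ≤ ε') →
        ∃ U : GaugeField (F.P K) 0 (Matrix.specialUnitaryGroup (Fin 2) ℂ),
          (∀ b : PBond (F.P K) k, b ∈ bondsIn k (Omega 𝔠.lane.carrier.M₁
              (rcolOf (T3Scales F γ hγ (hγ1.trans (sq_min_one_le _ 𝔠.gamma0_pos)) K) 𝔠.lane.carrier) (k + 1) h (k + 1)) →
            Averaging.iter (fun i => BlockAveraging.blockAvg (P := F.P K) (j := i) ℰp) k U b = V b) ∧
          ∀ q : Plaq (F.P K) 0, q ∈ plaqsIn 0 (Omega 𝔠.lane.carrier.M₁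
              (rcolOf (T3Scales F γ hγ (hγ1.trans (sq_min_one_le _ 𝔠.gamma0_pos)) K) 𝔠.lane.carrier) (k + 1) h (k + 1)) →
            GaugeGroup.dist1 (GaugeField.plaqHol U q) ≤ Bbig * (ε' / (((F.P K).L : ℝ) ^ k) ^ 2))
    {B₀ A₀ A₁ : ℝ} (hA₀ : 0 < A₀) (hA₁ : 0 < A₁)
    (hO : ∀ (B a₀ a₁ : ℝ), B₀ ≤ B → 1 ≤ 2 * B → 0 < a₀ → a₀ ≤ A₀ → 0 < a₁ → a₁ ≤ A₁ → B * a₁ ≤ a₀ →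
        (143 * ((((3 + 4 : ℕ) : ℝ)) ^ 2 / 4) ^ 2) * (2 * (B * a₁)) ≤ 1 / 3 →
        2 * (2 * (B * a₁)) ≤ 2 * deltaSU (Fin 2) / (((3 + 4) * L : ℕ) : ℝ) ^ 2 →
        Thm1GlobalMinAt L a₀ a₁ B →
        ∃ (b₁ p₁ : ℝ), ∀ (b₀ p₀ : ℝ), b₁ ≤ b₀ → p₁ ≤ p₀ →
          ∃ 𝔠 : AlphaConsts L (suGroupModel 2).N, 𝔠.b₀ = b₀ ∧ 𝔠.p₀ = p₀ ∧ 𝔠.B₃ = B ∧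
            4 * 𝔠.B₃ * (L : ℝ) ^ 2 * avgWindowFactor L ≤ 𝔠.C68 ∧
            Real.exp (𝔠.p₀ - 1) ≤ 3 * C0 3 * 𝔠.C68 * (𝔠.b₀ * Q0 𝔠.p₀) ∧
            (𝔠.b₀ * Q0 𝔠.p₀) * (2 * (L : ℝ) ^ 2 * avgWindowFactor L) ^ 2 ≤ 3 * C0 3 * 𝔠.C68 * a₁ ^ 2 ∧
            7 * L + 3 ≤ 𝔠.M₁ ∧
            ∀ (F : T3Family) (hF : F.L = L),
              (∀ (γ : ℝ) (hγ : 0 < γ) (hγ1 : γ ≤ (min (hF ▸ 𝔠).gamma0 1) ^ 2) (K : ℕ),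
                (∃ Ut : (k : ℕ) → GaugeField (F.P K) k (Matrix.specialUnitaryGroup (Fin 2) ℂ) →
                    GaugeField (F.P K) 0 (Matrix.specialUnitaryGroup (Fin 2) ℂ),
                  AlphaInputsT3AC.TrivMinimiserRowsT3 F (hF ▸ 𝔠) γ hγ hγ1 a₀ a₁ K Ut) →
                ∃ Ut : (k : ℕ) → GaugeField (F.P K) k (Matrix.specialUnitaryGroup (Fin 2) ℂ) →
                    GaugeField (F.P K) 0 (Matrix.specialUnitaryGroup (Fin 2) ℂ),
                  AlphaInputsT3AC.TrivMinimiserRowsT3 F (hF ▸ 𝔠) γ hγ hγ1 a₀ a₁ K Ut ∧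
                    AlphaInputsT3AC.DataRowsT3XChi F (hF ▸ 𝔠) γ hγ hγ1 K Ut)) :
    AlphaInputsT3ACv3RecChi L :=
  alphaInputsT3ACv3RecChi_of_pinnedPartsRecFLChi (pinnedPartsT3ACRecFLChi_of_thm1_bigClause_dataRows hL hT hε hBig hA₀ hA₁ hO)

/-! ## §2 The crux from T8's text, the big-k clause at every odd `L`, and the (O″χ) rows -/

/-- ★★★ **`HistoryTailL` ⇐ ⟨v5kC's T8 TEXT⟩ ∧ (∀ odd `L > 1`, `∃ B_big, ε_FL > 0`: THE (FL) BIG-k CLAUSE) ∧ (∀ odd `L > 1`, THE (O″χ) ROWS)** — stmt-QuantumFields-19936 by name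
from three independently owned deliverables: 19200's line (T8); the (FL) team's M22 clause `hLift_clause_of_start` closed over records, families, couplings and runs at its own
numerals `(B_big, ε_FL)(L)`; NODE O's χ data rows for its own records — VERBATIM the `hO` of `…OneSupplierSplit.historyTailL_of_thm1In8_fineLifts_dataRows_allL` (the kinematic
floor and the window row are absorbed into the served floor inside §1).
[cite: Balaban1985UV3, (5) p.256, (45)+(47) p.267, (71) p.273 and Thm 2 p.272; Balaban1985Variational, Thm 1 (8) p.279, (11)–(15) pp.279–280 and Prop 8 p.304; King1986, (3.12) p.657] -/
theorem historyTailL_of_thm1In8_bigClause_dataRows_allL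
    (hT8 : ∀ L : ℕ, Odd L → 1 < L → ∃ a₀ a₁ B₃ : ℝ, 0 < a₀ ∧ 0 < a₁ ∧ 0 < B₃ ∧
      Thm1GlobalMinAt L a₀ a₁ B₃ ∧ MinimisersIn8At L a₀ a₁ B₃)
    (hBig : ∀ L : ℕ, Odd L → 1 < L → ∃ (Bbig εFL : ℝ), 0 < εFL ∧
      ∀ (F : T3Family) (hF : F.L = L) (𝔠 : AlphaConsts F.L (suGroupModel 2).N) (γ : ℝ) (hγ : 0 < γ) (hγ1 : γ ≤ (min 𝔠.gamma0 1) ^ 2) (K : ℕ),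
      ∀ (k : ℕ), k + 1 ≤ K → 16 ≤ (F.P K).L ^ k → 4 * (F.P K).L ^ k ≤ (F.P K).sitesPerDir 0 → ∀ (h : Hist (F.P K) (k + 1)),
      Hist.Admissible 𝔠.lane.carrier.M₁ (rcolOf (T3Scales F γ hγ (hγ1.trans (sq_min_one_le _ 𝔠.gamma0_pos)) K) 𝔠.lane.carrier) (k + 1) h →
      h ≠ Hist.triv (F.P K) (k + 1) → ∀ (V : GaugeField (F.P K) k (Matrix.specialUnitaryGroup (Fin 2) ℂ)) (ε' : ℝ), 0 < ε' → ε' ≤ εFL →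
        (∀ Q : Plaq (F.P K) k, Q ∈ plaqsIn k (Omega 𝔠.lane.carrier.M₁
            (rcolOf (T3Scales F γ hγ (hγ1.trans (sq_min_one_le _ 𝔠.gamma0_pos)) K) 𝔠.lane.carrier) (k + 1) h (k + 1)) →
          GaugeGroup.dist1 (GaugeField.plaqHol V Q) ≤ ε') →
        ∃ U : GaugeField (F.P K) 0 (Matrix.specialUnitaryGroup (Fin 2) ℂ),
          (∀ b : PBond (F.P K) k, b ∈ bondsIn k (Omega 𝔠.lane.carrier.M₁
              (rcolOf (T3Scales F γ hγ (hγ1.trans (sq_min_one_le _ 𝔠.gamma0_pos)) K) 𝔠.lane.carrier) (k + 1) h (k + 1)) →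
            Averaging.iter (fun i => BlockAveraging.blockAvg (P := F.P K) (j := i) ℰp) k U b = V b) ∧
          ∀ q : Plaq (F.P K) 0, q ∈ plaqsIn 0 (Omega 𝔠.lane.carrier.M₁
              (rcolOf (T3Scales F γ hγ (hγ1.trans (sq_min_one_le _ 𝔠.gamma0_pos)) K) 𝔠.lane.carrier) (k + 1) h (k + 1)) →
            GaugeGroup.dist1 (GaugeField.plaqHol U q) ≤ Bbig * (ε' / (((F.P K).L : ℝ) ^ k) ^ 2))
    (hO : ∀ L : ℕ, Odd L → 1 < L → ∃ (B₀ A₀ A₁ : ℝ), 0 < A₀ ∧ 0 < A₁ ∧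
      ∀ (B a₀ a₁ : ℝ), B₀ ≤ B → 1 ≤ 2 * B → 0 < a₀ → a₀ ≤ A₀ → 0 < a₁ → a₁ ≤ A₁ → B * a₁ ≤ a₀ →
        (143 * ((((3 + 4 : ℕ) : ℝ)) ^ 2 / 4) ^ 2) * (2 * (B * a₁)) ≤ 1 / 3 →
        2 * (2 * (B * a₁)) ≤ 2 * deltaSU (Fin 2) / (((3 + 4) * L : ℕ) : ℝ) ^ 2 →
        Thm1GlobalMinAt L a₀ a₁ B →
        ∃ (b₁ p₁ : ℝ), ∀ (b₀ p₀ : ℝ), b₁ ≤ b₀ → p₁ ≤ p₀ →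
          ∃ 𝔠 : AlphaConsts L (suGroupModel 2).N, 𝔠.b₀ = b₀ ∧ 𝔠.p₀ = p₀ ∧ 𝔠.B₃ = B ∧
            4 * 𝔠.B₃ * (L : ℝ) ^ 2 * avgWindowFactor L ≤ 𝔠.C68 ∧
            Real.exp (𝔠.p₀ - 1) ≤ 3 * C0 3 * 𝔠.C68 * (𝔠.b₀ * Q0 𝔠.p₀) ∧
            (𝔠.b₀ * Q0 𝔠.p₀) * (2 * (L : ℝ) ^ 2 * avgWindowFactor L) ^ 2 ≤ 3 * C0 3 * 𝔠.C68 * a₁ ^ 2 ∧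
            7 * L + 3 ≤ 𝔠.M₁ ∧
            ∀ (F : T3Family) (hF : F.L = L),
              (∀ (γ : ℝ) (hγ : 0 < γ) (hγ1 : γ ≤ (min (hF ▸ 𝔠).gamma0 1) ^ 2) (K : ℕ),
                (∃ Ut : (k : ℕ) → GaugeField (F.P K) k (Matrix.specialUnitaryGroup (Fin 2) ℂ) →
                    GaugeField (F.P K) 0 (Matrix.specialUnitaryGroup (Fin 2) ℂ),
                  AlphaInputsT3AC.TrivMinimiserRowsT3 F (hF ▸ 𝔠) γ hγ hγ1 a₀ a₁ K Ut) →
                ∃ Ut : (k : ℕ) → GaugeField (F.P K) k (Matrix.specialUnitaryGroup (Fin 2) ℂ) →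
                    GaugeField (F.P K) 0 (Matrix.specialUnitaryGroup (Fin 2) ℂ),
                  AlphaInputsT3AC.TrivMinimiserRowsT3 F (hF ▸ 𝔠) γ hγ hγ1 a₀ a₁ K Ut ∧
                    AlphaInputsT3AC.DataRowsT3XChi F (hF ▸ 𝔠) γ hγ hγ1 K Ut)) :
    Summit.QuantumFields.YangMills.Theses.UnitScaleTilt.HistoryTailL := by
  refine HistoryTailLaneTailChi.historyTailL_of_pinnedPartsRecFLChi fun L hLo hL => ?_
  obtain ⟨a₀, a₁, B₃, ha₀, ha₁, hB₃, hT, -⟩ := hT8 L hLo hL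
  obtain ⟨Bbig, εFL, hε, hbig⟩ := hBig L hLo hL
  obtain ⟨B₀, A₀, A₁, hA₀, hA₁, ho⟩ := hO L hLo hL
  exact pinnedPartsT3ACRecFLChi_of_thm1_bigClause_dataRows hL ⟨a₀, a₁, B₃, ha₀, ha₁, hB₃, hT⟩ hε hbig hA₀ hA₁ ho

/-! ## §3 The plain display and the 2′ text of item 19935 from the same deliverables (plain data rows) -/

/-- ★★ **THE 2′ DISPLAY OF RECORD (item 19935, plain data rows) FROM (T) AT ANY CONSTANTS, THE BIG-k CLAUSE, AND THE (O″) ROWS**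
(`RecordFLOneSupplier.pinnedPartsT3ACRecFL_of_thm1_rows` at the served floor `max B₀ (max (max (B_big+1) 257 · L²) (avgWindowFactor L ∕ (24·ε_FL)))`, the (FL) conjunct by
`HLiftWindowKnit.innerFineLiftsT3_of_clauses` ∘ `windowRow_of_floor`).
[cite: Balaban1985Variational, Thm 1 (6)–(8) pp.278–279, (11)–(15) pp.279–280; Balaban1985UV3, (7) p.257, (38)–(42) p.266, (45) p.267, (68) p.273, Thm 2 p.272] -/
theorem pinnedPartsT3ACRecFL_of_thm1_bigClause_dataRows {L : ℕ} (hL : 1 < L)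
    (hT : ∃ a₀ a₁ B₃ : ℝ, 0 < a₀ ∧ 0 < a₁ ∧ 0 < B₃ ∧ Thm1GlobalMinAt L a₀ a₁ B₃)
    {Bbig εFL : ℝ} (hε : 0 < εFL)
    (hBig : ∀ (F : T3Family) (hF : F.L = L) (𝔠 : AlphaConsts F.L (suGroupModel 2).N) (γ : ℝ) (hγ : 0 < γ) (hγ1 : γ ≤ (min 𝔠.gamma0 1) ^ 2) (K : ℕ),
      ∀ (k : ℕ), k + 1 ≤ K → 16 ≤ (F.P K).L ^ k → 4 * (F.P K).L ^ k ≤ (F.P K).sitesPerDir 0 → ∀ (h : Hist (F.P K) (k + 1)),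
      Hist.Admissible 𝔠.lane.carrier.M₁ (rcolOf (T3Scales F γ hγ (hγ1.trans (sq_min_one_le _ 𝔠.gamma0_pos)) K) 𝔠.lane.carrier) (k + 1) h →
      h ≠ Hist.triv (F.P K) (k + 1) → ∀ (V : GaugeField (F.P K) k (Matrix.specialUnitaryGroup (Fin 2) ℂ)) (ε' : ℝ), 0 < ε' → ε' ≤ εFL →
        (∀ Q : Plaq (F.P K) k, Q ∈ plaqsIn k (Omega 𝔠.lane.carrier.M₁
            (rcolOf (T3Scales F γ hγ (hγ1.trans (sq_min_one_le _ 𝔠.gamma0_pos)) K) 𝔠.lane.carrier) (k + 1) h (k + 1)) →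
          GaugeGroup.dist1 (GaugeField.plaqHol V Q) ≤ ε') →
        ∃ U : GaugeField (F.P K) 0 (Matrix.specialUnitaryGroup (Fin 2) ℂ),
          (∀ b : PBond (F.P K) k, b ∈ bondsIn k (Omega 𝔠.lane.carrier.M₁
              (rcolOf (T3Scales F γ hγ (hγ1.trans (sq_min_one_le _ 𝔠.gamma0_pos)) K) 𝔠.lane.carrier) (k + 1) h (k + 1)) →
            Averaging.iter (fun i => BlockAveraging.blockAvg (P := F.P K) (j := i) ℰp) k U b = V b) ∧
          ∀ q : Plaq (F.P K) 0, q ∈ plaqsIn 0 (Omega 𝔠.lane.carrier.M₁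
              (rcolOf (T3Scales F γ hγ (hγ1.trans (sq_min_one_le _ 𝔠.gamma0_pos)) K) 𝔠.lane.carrier) (k + 1) h (k + 1)) →
            GaugeGroup.dist1 (GaugeField.plaqHol U q) ≤ Bbig * (ε' / (((F.P K).L : ℝ) ^ k) ^ 2))
    {B₀ A₀ A₁ : ℝ} (hA₀ : 0 < A₀) (hA₁ : 0 < A₁)
    (hO : ∀ (B a₀ a₁ : ℝ), B₀ ≤ B → 1 ≤ 2 * B → 0 < a₀ → a₀ ≤ A₀ → 0 < a₁ → a₁ ≤ A₁ → B * a₁ ≤ a₀ →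
        (143 * ((((3 + 4 : ℕ) : ℝ)) ^ 2 / 4) ^ 2) * (2 * (B * a₁)) ≤ 1 / 3 →
        2 * (2 * (B * a₁)) ≤ 2 * deltaSU (Fin 2) / (((3 + 4) * L : ℕ) : ℝ) ^ 2 →
        Thm1GlobalMinAt L a₀ a₁ B →
        ∃ (b₁ p₁ : ℝ), ∀ (b₀ p₀ : ℝ), b₁ ≤ b₀ → p₁ ≤ p₀ →
          ∃ 𝔠 : AlphaConsts L (suGroupModel 2).N, 𝔠.b₀ = b₀ ∧ 𝔠.p₀ = p₀ ∧ 𝔠.B₃ = B ∧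
            4 * 𝔠.B₃ * (L : ℝ) ^ 2 * avgWindowFactor L ≤ 𝔠.C68 ∧
            Real.exp (𝔠.p₀ - 1) ≤ 3 * C0 3 * 𝔠.C68 * (𝔠.b₀ * Q0 𝔠.p₀) ∧
            (𝔠.b₀ * Q0 𝔠.p₀) * (2 * (L : ℝ) ^ 2 * avgWindowFactor L) ^ 2 ≤ 3 * C0 3 * 𝔠.C68 * a₁ ^ 2 ∧
            7 * L + 3 ≤ 𝔠.M₁ ∧
            ∀ (F : T3Family) (hF : F.L = L),
              (∀ (γ : ℝ) (hγ : 0 < γ) (hγ1 : γ ≤ (min (hF ▸ 𝔠).gamma0 1) ^ 2) (K : ℕ),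
                (∃ Ut : (k : ℕ) → GaugeField (F.P K) k (Matrix.specialUnitaryGroup (Fin 2) ℂ) →
                    GaugeField (F.P K) 0 (Matrix.specialUnitaryGroup (Fin 2) ℂ),
                  AlphaInputsT3AC.TrivMinimiserRowsT3 F (hF ▸ 𝔠) γ hγ hγ1 a₀ a₁ K Ut) →
                ∃ Ut : (k : ℕ) → GaugeField (F.P K) k (Matrix.specialUnitaryGroup (Fin 2) ℂ) →
                    GaugeField (F.P K) 0 (Matrix.specialUnitaryGroup (Fin 2) ℂ),
                  AlphaInputsT3AC.TrivMinimiserRowsT3 F (hF ▸ 𝔠) γ hγ hγ1 a₀ a₁ K Ut ∧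
                    AlphaInputsT3AC.DataRowsT3X F (hF ▸ 𝔠) γ hγ hγ1 K Ut)) :
    AlphaInputsT3AC.PinnedPartsT3ACRecFL L := by
  refine pinnedPartsT3ACRecFL_of_thm1_rows hL hT hA₀ hA₁ (B₀ := max B₀ (max (max (Bbig + 1) 257 * (L : ℝ) ^ 2) (avgWindowFactor L / (24 * εFL))))
    fun B a₀ a₁ h1 h2 h3 h4 h5 h6 h7 h8 h9 h10 => ?_
  obtain ⟨b₁, p₁, hrec⟩ := hO B a₀ a₁ ((le_max_left _ _).trans h1) h2 h3 h4 h5 h6 h7 h8 h9 h10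
  refine ⟨b₁, p₁, fun b₀ p₀ hb hp => ?_⟩
  obtain ⟨𝔠, e1, e2, e3, s1, s2, s3, s4, hOF⟩ := hrec b₀ p₀ hb hp
  refine ⟨𝔠, e1, e2, e3, s1, s2, s3, s4, fun F hF => ⟨fun γ hγ hγ1 K => ?_, hOF F hF⟩⟩
  have hfl : max (max (Bbig + 1) 257 * (L : ℝ) ^ 2) (avgWindowFactor L / (24 * εFL)) ≤ 𝔠.B₃ := by
    rw [e3]; exact (le_max_right _ _).trans h1
  have hBB : max (Bbig + 1) 257 * (L : ℝ) ^ 2 ≤ 𝔠.B₃ := (le_max_left _ _).trans hfl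
  have hrow : avgWindowFactor L ≤ 8 * 𝔠.B₃ * 𝔠.Zfull * εFL := HLiftWindowKnit.windowRow_of_floor 𝔠 hε ((le_max_right _ _).trans hfl)
  subst hF
  exact innerFineLiftsT3_of_clauses F 𝔠 γ hγ hγ1 K hBB hrow (hBig F rfl 𝔠 γ hγ hγ1 K)

/-- ★★ **THE REGISTERED 2′ TEXT `AlphaInputsT3ACv3Rec L` (item 19935) FROM (T), THE BIG-k CLAUSE, AND THE (O″) ROWS** (the plain display through
`alphaInputsT3ACv3Rec_of_pinnedPartsRecFL`). [cite: Balaban1985UV3, Thm 2 p.272; Balaban1985Variational, Thm 1 (8) p.279] -/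
theorem alphaInputsT3ACv3Rec_of_thm1_bigClause_dataRows {L : ℕ} (hL : 1 < L)
    (hT : ∃ a₀ a₁ B₃ : ℝ, 0 < a₀ ∧ 0 < a₁ ∧ 0 < B₃ ∧ Thm1GlobalMinAt L a₀ a₁ B₃)
    {Bbig εFL : ℝ} (hε : 0 < εFL)
    (hBig : ∀ (F : T3Family) (hF : F.L = L) (𝔠 : AlphaConsts F.L (suGroupModel 2).N) (γ : ℝ) (hγ : 0 < γ) (hγ1 : γ ≤ (min 𝔠.gamma0 1) ^ 2) (K : ℕ),
      ∀ (k : ℕ), k + 1 ≤ K → 16 ≤ (F.P K).L ^ k → 4 * (F.P K).L ^ k ≤ (F.P K).sitesPerDir 0 → ∀ (h : Hist (F.P K) (k + 1)),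
      Hist.Admissible 𝔠.lane.carrier.M₁ (rcolOf (T3Scales F γ hγ (hγ1.trans (sq_min_one_le _ 𝔠.gamma0_pos)) K) 𝔠.lane.carrier) (k + 1) h →
      h ≠ Hist.triv (F.P K) (k + 1) → ∀ (V : GaugeField (F.P K) k (Matrix.specialUnitaryGroup (Fin 2) ℂ)) (ε' : ℝ), 0 < ε' → ε' ≤ εFL →
        (∀ Q : Plaq (F.P K) k, Q ∈ plaqsIn k (Omega 𝔠.lane.carrier.M₁
            (rcolOf (T3Scales F γ hγ (hγ1.trans (sq_min_one_le _ 𝔠.gamma0_pos)) K) 𝔠.lane.carrier) (k + 1) h (k + 1)) →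
          GaugeGroup.dist1 (GaugeField.plaqHol V Q) ≤ ε') →
        ∃ U : GaugeField (F.P K) 0 (Matrix.specialUnitaryGroup (Fin 2) ℂ),
          (∀ b : PBond (F.P K) k, b ∈ bondsIn k (Omega 𝔠.lane.carrier.M₁
              (rcolOf (T3Scales F γ hγ (hγ1.trans (sq_min_one_le _ 𝔠.gamma0_pos)) K) 𝔠.lane.carrier) (k + 1) h (k + 1)) →
            Averaging.iter (fun i => BlockAveraging.blockAvg (P := F.P K) (j := i) ℰp) k U b = V b) ∧
          ∀ q : Plaq (F.P K) 0, q ∈ plaqsIn 0 (Omega 𝔠.lane.carrier.M₁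
              (rcolOf (T3Scales F γ hγ (hγ1.trans (sq_min_one_le _ 𝔠.gamma0_pos)) K) 𝔠.lane.carrier) (k + 1) h (k + 1)) →
            GaugeGroup.dist1 (GaugeField.plaqHol U q) ≤ Bbig * (ε' / (((F.P K).L : ℝ) ^ k) ^ 2))
    {B₀ A₀ A₁ : ℝ} (hA₀ : 0 < A₀) (hA₁ : 0 < A₁)
    (hO : ∀ (B a₀ a₁ : ℝ), B₀ ≤ B → 1 ≤ 2 * B → 0 < a₀ → a₀ ≤ A₀ → 0 < a₁ → a₁ ≤ A₁ → B * a₁ ≤ a₀ →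
        (143 * ((((3 + 4 : ℕ) : ℝ)) ^ 2 / 4) ^ 2) * (2 * (B * a₁)) ≤ 1 / 3 →
        2 * (2 * (B * a₁)) ≤ 2 * deltaSU (Fin 2) / (((3 + 4) * L : ℕ) : ℝ) ^ 2 →
        Thm1GlobalMinAt L a₀ a₁ B →
        ∃ (b₁ p₁ : ℝ), ∀ (b₀ p₀ : ℝ), b₁ ≤ b₀ → p₁ ≤ p₀ →
          ∃ 𝔠 : AlphaConsts L (suGroupModel 2).N, 𝔠.b₀ = b₀ ∧ 𝔠.p₀ = p₀ ∧ 𝔠.B₃ = B ∧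
            4 * 𝔠.B₃ * (L : ℝ) ^ 2 * avgWindowFactor L ≤ 𝔠.C68 ∧
            Real.exp (𝔠.p₀ - 1) ≤ 3 * C0 3 * 𝔠.C68 * (𝔠.b₀ * Q0 𝔠.p₀) ∧
            (𝔠.b₀ * Q0 𝔠.p₀) * (2 * (L : ℝ) ^ 2 * avgWindowFactor L) ^ 2 ≤ 3 * C0 3 * 𝔠.C68 * a₁ ^ 2 ∧
            7 * L + 3 ≤ 𝔠.M₁ ∧
            ∀ (F : T3Family) (hF : F.L = L),
              (∀ (γ : ℝ) (hγ : 0 < γ) (hγ1 : γ ≤ (min (hF ▸ 𝔠).gamma0 1) ^ 2) (K : ℕ),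
                (∃ Ut : (k : ℕ) → GaugeField (F.P K) k (Matrix.specialUnitaryGroup (Fin 2) ℂ) →
                    GaugeField (F.P K) 0 (Matrix.specialUnitaryGroup (Fin 2) ℂ),
                  AlphaInputsT3AC.TrivMinimiserRowsT3 F (hF ▸ 𝔠) γ hγ hγ1 a₀ a₁ K Ut) →
                ∃ Ut : (k : ℕ) → GaugeField (F.P K) k (Matrix.specialUnitaryGroup (Fin 2) ℂ) →
                    GaugeField (F.P K) 0 (Matrix.specialUnitaryGroup (Fin 2) ℂ),
                  AlphaInputsT3AC.TrivMinimiserRowsT3 F (hF ▸ 𝔠) γ hγ hγ1 a₀ a₁ K Ut ∧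
                    AlphaInputsT3AC.DataRowsT3X F (hF ▸ 𝔠) γ hγ hγ1 K Ut)) :
    AlphaInputsT3ACv3Rec L :=
  alphaInputsT3ACv3Rec_of_pinnedPartsRecFL (pinnedPartsT3ACRecFL_of_thm1_bigClause_dataRows hL hT hε hBig hA₀ hA₁ hO)

end Summit.QuantumFields.YangMills.Theorems.HistoryTailOneSupplier

end
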